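import Summits.BirchSwinnertonDyer.BirchSwinnertonDyer.Theses.PrintX6
import Literature.NumberTheory.EllipticCurves.Rank1Residual.Predicates
import HarnessLib

/-!
# Route `PrintX6`, item `Assembly` (stmt-BirchSwinnertonDyer-20303): the value-cell split, proved

HONEST FRAMING (cell `bsd-print-x6`, run/shared/lean/pub/bsd-print-x6/; PRINT tier D-0131 (2);
prover p2). THEOREMS ONLY; pure bookkeeping over the route's own items — nothing about any curve is
asserted, no named fact is consumed except through the route's hypotheses, BSD is not proved by any
of this.

The route's assembly item reads
`PublishedInputsX6 → UpperHalfX6 → EisensteinHalfFiveLe → EisensteinHalfAtThree → WAllCornerX6r0`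
(`Theses/PrintX6.lean`, rev 0). Its proof is the VALUE-CELL SPLIT of the leaf
`WAllCornerX6r0 : ∀ W p, ¬CM → p ≠ 2 → ClassX6 W p → r_an = 0 → BSDp W p`:
fix such a pair; `UpperHalfX6` (fed `PublishedInputsX6`) gives the rational `q = #Ш(E)_an` with
`ord_p #Ш ≤ ord_p q` (`MissingUpperBoundAt W p`);
* UNIT cell (`ord_p q = 0`): the lower half `ord_p q ≤ ord_p #Ш` is `0 ≤ ord_p #Ш` — trivial;
* NON-UNIT cell at `p ≥ 5`: the lower half is `EisensteinHalfFiveLe`;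
* NON-UNIT cell at `p = 3`: the lower half is `EisensteinHalfAtThree` (an odd prime `< 5` is `3`;
  the clause `a_3 = 0` sits inside `ClassX6 W 3`);
in every case the two halves give `MissingPPartAt W p` and Miller's `BSD(E,p)` follows by
`Typed.bsdp_of_missingPPartAt` with GZK = the last conjunct of `PublishedInputsX6`.
So the leaf is EXACTLY: the flag-free upper half (item `UpperHalfX6`, this seat's
`PrintX6KobayashiUpperHalf.lean`) + the two Eisenstein-half cruxes on the non-unit cells.
[cite: Miller2011LMS, §1 and Def. 1.1]
-/

set_option autoImplicit false
-- the landed namespace `Summit.BirchSwinnertonDyer.BirchSwinnertonDyer.Theorems` (summit = problem) trips the linter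
set_option linter.dupNamespace false

noncomputable section

open scoped Classical

open WeierstrassCurve Literature.NumberTheory.EllipticCurves
  Literature.NumberTheory.EllipticCurves.Rank1Residual
  Literature.NumberTheory.EllipticCurves.Rank1Residual.Typed
  Summit.BirchSwinnertonDyer.BirchSwinnertonDyer.Theses.PrintX6

namespace Summit.BirchSwinnertonDyer.BirchSwinnertonDyer.Theorems

/-- **The value-cell split (pure bookkeeping).** For ANY upper-half statement and ANY pair of
lower-half statements on the non-unit cells (split at `p ≥ 5` / `p = 3`), the leaf `WAllCornerX6r0`
follows, granted GZK for `rank = r_an` and `Ш` finite: at a pair of the leaf, `#Ш_an = q` with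
`ord_p #Ш ≤ ord_p q` (upper half); if `ord_p q = 0` the lower bound is `0 ≤ ord_p #Ш`, otherwise it
is the `p ≥ 5` or the `p = 3` Eisenstein half (an odd prime below `5` is `3`); then
`MissingPPartAt W p` and `bsdp_of_missingPPartAt`. [cite: Miller2011LMS, §1 and Def. 1.1] -/
theorem wallCornerX6r0_of_upper_of_eisensteinHalves
    (hGZK : rank_eq_analyticRank_of_analyticRank_le_one)
    (hU : ∀ (W : WeierstrassCurve ℚ) [W.IsElliptic] [W.IsGloballyMinimal] (p : ℕ) [Fact p.Prime],
      p ≠ 2 → ClassX6 W p → W.analyticRank = 0 → MissingUpperBoundAt W p)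
    (h5 : EisensteinHalfFiveLe) (h3 : EisensteinHalfAtThree) :
    Summit.BirchSwinnertonDyer.WAllCornerX6r0 := by
  intro W _ _ p _ hcm hp hX h0
  have hpP : p.Prime := Fact.out
  obtain ⟨q, hq, hup⟩ := hU W p hp hX h0
  refine bsdp_of_missingPPartAt W p hGZK (by omega) ⟨q, hq, le_antisymm ?_ hup⟩
  by_cases hv : padicValRat p q = 0
  · -- UNIT cell: the trivial lower bound
    rw [hv]; exact_mod_cast Nat.zero_le _
  · -- NON-UNIT cell: an odd prime is `≥ 5` or `= 3`
    rcases Nat.lt_or_ge p 5 with hlt | hge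
    · have hp3 : p = 3 := by
        have h2 := hpP.two_le
        interval_cases p
        · exact absurd rfl hp
        · rfl
        · exact absurd hpP (by decide)
      exact h3 W p hcm hp3 hX h0 q hq hv
    · exact h5 W p hcm hge hX h0 q hq hv

/-- **Route `PrintX6`, item `Assembly` (stmt-BirchSwinnertonDyer-20303), proved**:
`PublishedInputsX6 → UpperHalfX6 → EisensteinHalfFiveLe → EisensteinHalfAtThree → WAllCornerX6r0` —
`UpperHalfX6` is fed the published inputs, GZK is their last conjunct, and the value-cell split
`wallCornerX6r0_of_upper_of_eisensteinHalves` does the rest. [cite: Miller2011LMS, §1 and Def. 1.1] -/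
theorem printX6_assembly_proof : Summit.BirchSwinnertonDyer.BirchSwinnertonDyer.Theses.PrintX6.Assembly := by
  intro hPub hU h5 h3
  exact wallCornerX6r0_of_upper_of_eisensteinHalves hPub.2.2.2.2.2.2.2.2 (hU hPub) h5 h3

/-- **Corollary: on the route's inputs the leaf needs only the two Eisenstein halves** — with
`UpperHalfX6` PROVED (`PrintX6KobayashiUpperHalf.lean`: Kobayashi Thm. 4.1 / 1.2 + Kim Cor. 3.15 +
period units + modularity + GZK), `PublishedInputsX6 ∧ EisensteinHalfFiveLe ∧ EisensteinHalfAtThree`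
give `WAllCornerX6r0` through `Assembly`. Stated with `UpperHalfX6` as a hypothesis so that this file
does not depend on the sibling's landing order. [cite: Miller2011LMS, §1 and Def. 1.1] -/
theorem wallCornerX6r0_of_publishedInputs_of_upperHalf_of_eisensteinHalves
    (hPub : PublishedInputsX6) (hU : UpperHalfX6) (h5 : EisensteinHalfFiveLe)
    (h3 : EisensteinHalfAtThree) : Summit.BirchSwinnertonDyer.WAllCornerX6r0 :=
  printX6_assembly_proof hPub hU h5 h3

end Summit.BirchSwinnertonDyer.BirchSwinnertonDyer.Theorems

end
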